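import Summits.Ventures.HodgeRepro2.T5SU11ReductionOfOrderInfinity

/-!
# The asymptotics of the tail integral and of the decaying solution: `e^{bt} ∫_t^∞ h → C/b` when `e^{bt} h(t) → C`

The tail integral `T(t) = ∫_t^∞ g` of row 447 decays exactly like its integrand divided by the rate: this file
proves the elementary Tauberian-type statement behind it —

  **if `h` is integrable on `(a, ∞)`, `b > 0` and `e^{bt} h(t) → C`, then `e^{bt} ∫_t^∞ h(s) ds → C/b`**
  (`tendsto_exp_mul_integral_Ioi`),

by squeezing: for `t` large, `(C − δ) e^{−bs} ≤ h(s) ≤ (C + δ) e^{−bs}` on `(t, ∞)`, and `∫_t^∞ e^{−bs} ds = e^{−bt}/b`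
(`integral_exp_neg_mul_Ioi`, the improper fundamental theorem of calculus), so `(C − δ)/b ≤ e^{bt} ∫_t^∞ h ≤ (C + δ)/b`.
Applied to the reduction-of-order integrand `g = 1/(sinh 2s · φ²)`: **if `e^{bt} g(t) → C` then `e^{bt} T(t) → C/b`**
(`tendsto_exp_mul_tailIntegral`) and **`e^{bt} χ(t)/φ(t) → C/b`** for the decaying solution `χ = φ T`
(`tendsto_exp_mul_decaySolution_div`). Nothing is claimed about (N).

Blind lane: Mathlib + the HodgeRepro2 prefix only; no sorry; axioms ⊆ {propext, Classical.choice,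
Quot.sound}.
-/

namespace Summit.Ventures.HodgeRepro2.T5SU11ReductionOfOrderAsymptotic

open Filter Topology MeasureTheory
open Set (Ioi)
open T5SU11ReductionOfOrder T5SU11ReductionOfOrderInfinity

/-! ### `∫_t^∞ e^{−bs} ds = e^{−bt}/b` -/

/-- `(d/ds) (−e^{−bs}/b) = e^{−bs}` for `b ≠ 0`. -/
theorem hasDerivAt_neg_exp_neg_mul_div {b : ℝ} (hb : b ≠ 0) (s : ℝ) :
    HasDerivAt (fun s => -Real.exp (-b * s) / b) (Real.exp (-b * s)) s := by
  have h := ((Real.hasDerivAt_exp (-b * s)).comp s ((hasDerivAt_id s).const_mul (-b))).neg.div_const b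
  refine h.congr_deriv ?_
  simp only [mul_one]
  rw [mul_neg, neg_neg, mul_div_assoc, div_self hb, mul_one]

/-- **`∫_t^∞ e^{−bs} ds = e^{−bt}/b`** for `b > 0`. -/
theorem integral_exp_neg_mul_Ioi {b : ℝ} (hb : 0 < b) (t : ℝ) :
    ∫ s in Ioi t, Real.exp (-b * s) = Real.exp (-b * t) / b := by
  have hlim : Tendsto (fun s => -Real.exp (-b * s) / b) atTop (𝓝 0) := by
    have h1 : Tendsto (fun s : ℝ => -b * s) atTop atBot := tendsto_id.const_mul_atTop_of_neg (by linarith)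
    have h2 := (Real.tendsto_exp_atBot.comp h1).neg.div_const b
    simpa only [Function.comp_def, neg_zero, zero_div] using h2
  have := integral_Ioi_of_hasDerivAt_of_tendsto' (a := t) (fun x _ => hasDerivAt_neg_exp_neg_mul_div hb.ne' x)
    (exp_neg_integrableOn_Ioi t hb) hlim
  rw [this]
  ring

/-! ### The Tauberian squeeze -/

/-- `e^{−bs} e^{bs} = 1`. -/
theorem exp_neg_mul_mul_exp_mul (b s : ℝ) : Real.exp (-b * s) * Real.exp (b * s) = 1 := by
  rw [← Real.exp_add, show -b * s + b * s = 0 by ring, Real.exp_zero]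

/-- **If `h` is integrable on `(a, ∞)` and `e^{bt} h(t) → C` (`b > 0`), then `e^{bt} ∫_t^∞ h → C/b`.** -/
theorem tendsto_exp_mul_integral_Ioi {h : ℝ → ℝ} {a b C : ℝ} (hb : 0 < b) (hint : IntegrableOn h (Ioi a))
    (hlim : Tendsto (fun t => Real.exp (b * t) * h t) atTop (𝓝 C)) :
    Tendsto (fun t => Real.exp (b * t) * ∫ s in Ioi t, h s) atTop (𝓝 (C / b)) := by
  rw [Metric.tendsto_atTop]
  intro ε hε
  set δ := ε * b / 2 with hδ
  have hδ0 : 0 < δ := by positivity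
  obtain ⟨T, hT⟩ := Metric.tendsto_atTop.mp hlim δ hδ0
  refine ⟨max T a, fun t ht => ?_⟩
  have htT : T ≤ t := le_trans (le_max_left _ _) ht
  have hta : a ≤ t := le_trans (le_max_right _ _) ht
  have hintt : IntegrableOn h (Ioi t) := hint.mono_set (Set.Ioi_subset_Ioi hta)
  have hexp : IntegrableOn (fun s => Real.exp (-b * s)) (Ioi t) := exp_neg_integrableOn_Ioi t hb
  -- the pointwise squeeze on `(t, ∞)`
  have hpt : ∀ s ∈ Ioi t, (C - δ) * Real.exp (-b * s) ≤ h s ∧ h s ≤ (C + δ) * Real.exp (-b * s) := by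
    intro s hs
    have hs' : T ≤ s := le_trans htT (le_of_lt hs)
    have hd := hT s hs'
    rw [Real.dist_eq, abs_lt] at hd
    have hE : 0 < Real.exp (-b * s) := Real.exp_pos _
    have hsplit : h s = Real.exp (-b * s) * (Real.exp (b * s) * h s) := by
      rw [← mul_assoc, exp_neg_mul_mul_exp_mul, one_mul]
    constructor
    · calc (C - δ) * Real.exp (-b * s) = Real.exp (-b * s) * (C - δ) := by ring
        _ ≤ Real.exp (-b * s) * (Real.exp (b * s) * h s) :=
          mul_le_mul_of_nonneg_left (by linarith [hd.1]) hE.le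
        _ = h s := hsplit.symm
    · calc h s = Real.exp (-b * s) * (Real.exp (b * s) * h s) := hsplit
        _ ≤ Real.exp (-b * s) * (C + δ) := mul_le_mul_of_nonneg_left (by linarith [hd.2]) hE.le
        _ = (C + δ) * Real.exp (-b * s) := by ring
  -- the integrated squeeze
  have hupper : ∫ s in Ioi t, h s ≤ (C + δ) * (Real.exp (-b * t) / b) := by
    calc ∫ s in Ioi t, h s ≤ ∫ s in Ioi t, (C + δ) * Real.exp (-b * s) :=
          setIntegral_mono_on hintt (hexp.const_mul _) measurableSet_Ioi (fun s hs => (hpt s hs).2)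
      _ = (C + δ) * (Real.exp (-b * t) / b) := by
          rw [MeasureTheory.integral_const_mul, integral_exp_neg_mul_Ioi hb]
  have hlower : (C - δ) * (Real.exp (-b * t) / b) ≤ ∫ s in Ioi t, h s := by
    calc (C - δ) * (Real.exp (-b * t) / b) = ∫ s in Ioi t, (C - δ) * Real.exp (-b * s) := by
          rw [MeasureTheory.integral_const_mul, integral_exp_neg_mul_Ioi hb]
      _ ≤ ∫ s in Ioi t, h s :=
          setIntegral_mono_on (hexp.const_mul _) hintt measurableSet_Ioi (fun s hs => (hpt s hs).1)
  -- multiply by `e^{bt}`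
  have hEt : 0 < Real.exp (b * t) := Real.exp_pos _
  have hprod : Real.exp (b * t) * Real.exp (-b * t) = 1 := by
    rw [mul_comm]; exact exp_neg_mul_mul_exp_mul b t
  have hU : Real.exp (b * t) * ∫ s in Ioi t, h s ≤ (C + δ) / b := by
    calc Real.exp (b * t) * ∫ s in Ioi t, h s ≤ Real.exp (b * t) * ((C + δ) * (Real.exp (-b * t) / b)) :=
          mul_le_mul_of_nonneg_left hupper hEt.le
      _ = (C + δ) / b * (Real.exp (b * t) * Real.exp (-b * t)) := by ring
      _ = (C + δ) / b := by rw [hprod, mul_one]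
  have hL : (C - δ) / b ≤ Real.exp (b * t) * ∫ s in Ioi t, h s := by
    calc (C - δ) / b = Real.exp (b * t) * ((C - δ) * (Real.exp (-b * t) / b)) := by
          rw [show Real.exp (b * t) * ((C - δ) * (Real.exp (-b * t) / b))
              = (C - δ) / b * (Real.exp (b * t) * Real.exp (-b * t)) by ring, hprod, mul_one]
      _ ≤ Real.exp (b * t) * ∫ s in Ioi t, h s := mul_le_mul_of_nonneg_left hlower hEt.le
  -- conclude: `|e^{bt} ∫ − C/b| ≤ δ/b = ε/2 < ε`
  rw [Real.dist_eq, abs_lt]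
  have e1 : (C + δ) / b = C / b + ε / 2 := by rw [hδ]; field_simp
  have e2 : (C - δ) / b = C / b - ε / 2 := by rw [hδ]; field_simp
  constructor <;> linarith

/-! ### The tail integral and the decaying solution -/

section

variable {φ : ℝ → ℝ} {b C : ℝ} (hpos : ∀ t, 0 < t → 0 < φ t) (hint : IntegrableOn (roIntegrand φ) (Ioi 1))

include hint in
/-- **If `e^{bt} g(t) → C` (`b > 0`) then `e^{bt} T(t) → C/b`** for the tail integral `T = ∫_t^∞ g`. -/
theorem tendsto_exp_mul_tailIntegral (hb : 0 < b)
    (hlim : Tendsto (fun t => Real.exp (b * t) * roIntegrand φ t) atTop (𝓝 C)) :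
    Tendsto (fun t => Real.exp (b * t) * tailIntegral φ t) atTop (𝓝 (C / b)) :=
  tendsto_exp_mul_integral_Ioi hb hint hlim

include hpos hint in
/-- **`e^{bt} χ(t)/φ(t) → C/b`** for the decaying solution `χ = φ T`. -/
theorem tendsto_exp_mul_decaySolution_div (hb : 0 < b)
    (hlim : Tendsto (fun t => Real.exp (b * t) * roIntegrand φ t) atTop (𝓝 C)) :
    Tendsto (fun t => Real.exp (b * t) * (decaySolution φ t / φ t)) atTop (𝓝 (C / b)) := by
  refine (tendsto_exp_mul_tailIntegral hint hb hlim).congr' ?_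
  filter_upwards [eventually_gt_atTop 0] with t ht
  unfold decaySolution
  rw [mul_div_cancel_left₀ _ (hpos t ht).ne']

end

end Summit.Ventures.HodgeRepro2.T5SU11ReductionOfOrderAsymptotic
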